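import Mathlib
import HarnessLib
import Literature.Probability.LatticeModels.LatticeGreenFunction
import Summits.QuantumFields.YangMills.Theses.LangevinControlUV

/-!
# Line `deep-band-gaussian-regime` — skeleton for crux `FemtoCurvatureTwoPoint`
(item stmt-QuantumFields-9363, route LangevinControlUV; crux-plan, round 1)

Idea (card `Ideas/deep-band-gaussian-regime.md`): trade the existential unit map for BAND DEPTH.
On every torus of the deep band `log L ≤ β/M` the coupling does not renormalise
(`Σ_j g_j² ≤ C/M`), a reflection-positivity chessboard + union bound deletes all order-one
plaquette fields, and on the surviving small-field body Wilson's measure is a Gaussian-dominated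
non-convex gradient model at low temperature; the band theorem
C⁺ = `DeepBandTwoPoint` (`c ≤ β² n⁸ Cov ≤ C`, `β² |Cov| dist⁸ ≤ C`, constants uniform in ALL
`(L, β)` of the band) then implies the crux by the generic-step encoding (kernel-certified,
§ Encoding below, adapted verbatim from `Cruxes/FemtoCurvatureTwoPoint/SketchIdeator2.lean`).

## Stubs (registered; `sorry` ONLY here)

* `stub_largeFieldDeletion`  — S₁, RP chessboard tail + union bound + reweighting: in the band any
  measurable regulator `W ∈ [0,1]` equal to `1` on the body `{∀ p, P_p ≤ δ}` moves plaquette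
  covariances by `≤ K e^{-c₁ β}` (size M/L; even `L` from tree RP, odd `L` flagged).
* `stub_maxwellKernelBand`   — S₂, the bare-coupling comparison Gaussian: the lattice Maxwell
  kernel `K_L(n e₂) = -Δ_{01} G_L(n e₂)` (tree `torusGreen`) obeys `c ≤ n⁴ K_L ≤ C` for
  `1 ≤ n ≤ L/8` uniformly in `L` (size M; provable now; numerics `π² n⁴ K_L ∈ [0.68, 1.81]`).
* `stub_bodyCovarianceDecay` — S₃, engine output 1 (AKM/Hilger-type decay on the regulated
  measure): all-pairs bound `β² |Cov_W| dist⁸ ≤ C` (size XL).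
* `stub_bodyAxisTwoSided`    — S₄, engine output 2, the HARDEST stub (leading-term dominance):
  S₂ ⇒ `c ≤ β² n⁸ Cov_W(axis n) ≤ C`, `n ≤ L/8` (size XL).

## Composition (no `sorry` outside the stubs)

`deepBand_of_stubs : S₁ → S₂ → S₃ → (S₂ → S₄) → DeepBandTwoPoint` (explicit error budget:
`M ≥ 16/c₁`, `|K| β² e^{-c₁β/2} → 0`, `n⁸, dist⁸ ≤ L⁸ ≤ e^{8β/M}`; axioms
`propext, Classical.choice, Quot.sound`), the encoding `crux_of_deepBand` (§ Encoding), and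
`FemtoCurvatureTwoPoint_of : FemtoCurvatureTwoPoint` — the ONLY declaration concluding the crux,
by name — which applies both to the four stubs.

Disproof honoured (Disproof.lean gen 1 v3): faithfulness (`not_packageRho_one`) and the
connected Lie fibre (§Resists 3, landed `Negative.FiniteGroup*`) are used at S₄ (the lower
bound); the forced dividend (`PackageWith.tendsto_gamma`, `Negative.ForcedDividend`) is carried
by the `β⁻²` of C⁺ through `Γ = 4^{-k}`; no stub bounds `Γ` below (`not_packageWith_const`).
-/

open scoped BigOperators
open MeasureTheory Filter Topology

namespace Summit.QuantumFields.YangMills.Cruxes.FemtoCurvatureTwoPoint.DeepBandGaussianRegime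

open Literature.MathematicalPhysics.QuantumFieldTheory

/-! ## § Stubs -/

/-- **S₁ — large-field deletion** (chessboard estimate from four-direction reflection positivity
of Wilson's action, Fröhlich–Israel–Lieb–Simon CMP 62 (1978); denominator from the Haar
small-ball bound `haar_unitaryOpBall_ge`; union bound over the `6L⁴ ≤ 6e^{4β/M₁}` plaquettes of a
band torus; then elementary reweighting). For every `δ > 0` there are `M₁, β₁, K, c₁ > 0` such
that on every torus of the band `log L ≤ β/M₁`, `β ≥ β₁`, and for every measurable regulator
`0 ≤ W ≤ 1` with `W = 1` on the small-field body `{U | ∀ plaquettes, P ≤ δ}`, the covariance of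
any two plaquette fields under Wilson's measure and under the `W`-reweighted measure differ by at
most `K e^{-c₁ β}` (expected `c₁ = δ/2 - 4/M₁ > 0`; `Mδ > 24` of triage r1-3 is `M ≥ 16/c₁` in
`deepBand_of_stubs`). Odd `L`: the chessboard iteration needs the tree's odd-torus RP
(`wilsonExpectation_oddReflectionPositive`, `3 ≤ L`) or the tail must be taken inside the
expansion — flagged, not automatic. -/
theorem stub_largeFieldDeletion :
    ∀ (G : Type) [Group G] [TopologicalSpace G] [IsTopologicalGroup G] [CompactSpace G]
      [MeasurableSpace G] [BorelSpace G], IsCompactSimpleLieGroup G →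
    ∀ (r : LatticeRep G) (δ : ℝ), 0 < δ →
    ∃ (M₁ β₁ K c₁ : ℝ), 0 < M₁ ∧ 0 < c₁ ∧
      ∀ (L : ℕ) [NeZero L] (β : ℝ), β₁ ≤ β → Real.log (L : ℝ) ≤ β / M₁ →
      ∀ (P : (Fin 4 → ZMod L) → Fin 4 → Fin 4 → GaugeConfig 4 L G → ℝ)
        (E : (GaugeConfig 4 L G → ℝ) → ℝ),
        (P = fun x i j U => (r.N : ℝ) - (r.ρ (plaquetteHolonomy U x i j)).trace.re) →
        (E = fun F => wilsonExpectation r.ρ β F) →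
      ∀ (W : GaugeConfig 4 L G → ℝ), Measurable W → (∀ U, 0 ≤ W U ∧ W U ≤ 1) →
        (∀ U, (∀ (z : Fin 4 → ZMod L) (k l : Fin 4), k ≠ l → P z k l U ≤ δ) → W U = 1) →
      ∀ (x y : Fin 4 → ZMod L) (i j i' j' : Fin 4),
        |(E (fun U => P x i j U * P y i' j' U) - E (P x i j) * E (P y i' j')) -
            (E (fun U => P x i j U * P y i' j' U * W U) / E W -
              E (fun U => P x i j U * W U) / E W * (E (fun U => P y i' j' U * W U) / E W))|
          ≤ K * Real.exp (-(c₁ * β)) := by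
  sorry

/-- **S₂ — the comparison Gaussian at the bare coupling (lattice Maxwell kernel band).**
`K_L(z) := ½ Σ_{μ ∈ {0,1}} (2 G̃_L(z) - G̃_L(z + e_μ) - G̃_L(z - e_μ))` with `G̃_L =` the tree's
`torusGreen` (`= L⁻⁴ Σ_{k ≠ 0} cos(p·z)/ε(p)`, `ε = ½ k̂²`) equals
`L⁻⁴ Σ_{k ≠ 0} (k̂₀² + k̂₁²)/k̂² cos(p·z)` — the tree-level `⟨F₀₁(0) F₀₁(z)⟩` kernel of lattice
Maxwell theory (any gauge), continuum value `1/(π² n⁴)` at `z = n e₂`. Claim: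
`c ≤ n⁴ K_L(n e₂) ≤ C` for `1 ≤ n ≤ L/8` uniformly in `L` (finite-size and zero-mode corrections
are `O(L⁻⁴) ≪ 8⁴/(π² L⁴)`; numerics `π² n⁴ K_L = 0.679, 1.760, 1.807` at `n = 1, 2, 3`,
`L`-independent to 4 digits: item evidence j006894 / kernel_check / slice_psd_tables and this
seat's kernel_local.py). Pure lattice Fourier analysis, provable now. -/
theorem stub_maxwellKernelBand :
    ∃ (c C : ℝ), 0 < c ∧ ∀ (L : ℕ) [NeZero L] (e₀ e₁ : Fin 4 → ZMod L) (K : (Fin 4 → ZMod L) → ℝ),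
      e₀ = Pi.single (0 : Fin 4) (1 : ZMod L) → e₁ = Pi.single (1 : Fin 4) (1 : ZMod L) →
      (K = fun z =>
        ((2 * Literature.Probability.LatticeModels.torusGreen z
            - Literature.Probability.LatticeModels.torusGreen (z + e₀)
            - Literature.Probability.LatticeModels.torusGreen (z - e₀))
          + (2 * Literature.Probability.LatticeModels.torusGreen z
            - Literature.Probability.LatticeModels.torusGreen (z + e₁)
            - Literature.Probability.LatticeModels.torusGreen (z - e₁))) / 2) →
      ∀ (n : ℕ), 1 ≤ n → 8 * n ≤ L →
        c ≤ (n : ℝ) ^ 4 * K (Pi.single (2 : Fin 4) ((n : ℕ) : ZMod L)) ∧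
          (n : ℝ) ^ 4 * K (Pi.single (2 : Fin 4) ((n : ℕ) : ZMod L)) ≤ C := by
  sorry

/-- **S₃ — engine output 1: covariance decay on the regulated measure** (Adams–Kotecký–Müller
weighted-norm finite-range RG for a low-temperature non-convex gradient model, covariance output
as in Hilger 2020, run in Bałaban's small-field chart (CMP 99, 1985) of the body; no coupling
renormalisation in the band). There are `δ, M > 0`, `β₀`, `C` such that on every band torus
(`log L ≤ β/M`, `β ≥ β₀`) some measurable regulator `0 ≤ W ≤ 1`, `W = 1` on the body
`{∀ p, P_p ≤ δ}` (the prover's choice: indicator, smooth cut-off, AKM weight …) has ALL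
plaquette-pair covariances of the `W`-reweighted measure bounded by `C β⁻² dist⁻⁸`. -/
theorem stub_bodyCovarianceDecay :
    ∀ (G : Type) [Group G] [TopologicalSpace G] [IsTopologicalGroup G] [CompactSpace G]
      [MeasurableSpace G] [BorelSpace G], IsCompactSimpleLieGroup G →
    ∀ (r : LatticeRep G), ∃ (δ M β₀ C : ℝ), 0 < δ ∧ 0 < M ∧
      ∀ (L : ℕ) [NeZero L] (β : ℝ), β₀ ≤ β → Real.log (L : ℝ) ≤ β / M →
      ∀ (P : (Fin 4 → ZMod L) → Fin 4 → Fin 4 → GaugeConfig 4 L G → ℝ)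
        (E : (GaugeConfig 4 L G → ℝ) → ℝ),
        (P = fun x i j U => (r.N : ℝ) - (r.ρ (plaquetteHolonomy U x i j)).trace.re) →
        (E = fun F => wilsonExpectation r.ρ β F) →
      ∃ (W : GaugeConfig 4 L G → ℝ), Measurable W ∧ (∀ U, 0 ≤ W U ∧ W U ≤ 1) ∧
        (∀ U, (∀ (z : Fin 4 → ZMod L) (k l : Fin 4), k ≠ l → P z k l U ≤ δ) → W U = 1) ∧
        ∀ (x y : Fin 4 → ZMod L) (i j i' j' : Fin 4), x ≠ y → i ≠ j → i' ≠ j' →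
          β ^ 2 * (|E (fun U => P x i j U * P y i' j' U * W U) / E W -
                E (fun U => P x i j U * W U) / E W * (E (fun U => P y i' j' U * W U) / E W)|
              * Real.sqrt (∑ k : Fin 4, (((x k - y k).valMinAbs : ℤ) : ℝ) ^ 2) ^ 8) ≤ C := by
  sorry

/-- **S₄ — engine output 2, the hardest stub: two-sided axis bound on the regulated measure**
(leading-term dominance: in the band the plaquette–plaquette covariance of the regulated measure
is the explicit positive Wick square `2 c_r² dim 𝔤 · K_L(n e₂)² β⁻²` up to a RELATIVE error
`O(1/M + 1/β)`; torons enter at the last scale with relative weight `O((n/L)⁴)`; the compact,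
CONNECTED, non-abelian fibre of `IsCompactSimpleLieGroup` and faithfulness of `r` are both
load-bearing here — Disproof §LoadBearing / §Resists 3). GIVEN the kernel band S₂ (stated
verbatim as the hypothesis), there are `δ, M, c > 0`, `β₀`, `C` such that on every band torus some
measurable regulator `0 ≤ W ≤ 1`, `W = 1` on the body, gives
`c ≤ β² n⁸ Cov_W(P_0^{01}, P_{n e₂}^{01}) ≤ C` for `1 ≤ n ≤ L/8`. -/
theorem stub_bodyAxisTwoSided :
    (∃ (c C : ℝ), 0 < c ∧ ∀ (L : ℕ) [NeZero L] (e₀ e₁ : Fin 4 → ZMod L) (K : (Fin 4 → ZMod L) → ℝ),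
        e₀ = Pi.single (0 : Fin 4) (1 : ZMod L) → e₁ = Pi.single (1 : Fin 4) (1 : ZMod L) →
        (K = fun z =>
          ((2 * Literature.Probability.LatticeModels.torusGreen z
              - Literature.Probability.LatticeModels.torusGreen (z + e₀)
              - Literature.Probability.LatticeModels.torusGreen (z - e₀))
            + (2 * Literature.Probability.LatticeModels.torusGreen z
              - Literature.Probability.LatticeModels.torusGreen (z + e₁)
              - Literature.Probability.LatticeModels.torusGreen (z - e₁))) / 2) →
        ∀ (n : ℕ), 1 ≤ n → 8 * n ≤ L →
          c ≤ (n : ℝ) ^ 4 * K (Pi.single (2 : Fin 4) ((n : ℕ) : ZMod L)) ∧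
            (n : ℝ) ^ 4 * K (Pi.single (2 : Fin 4) ((n : ℕ) : ZMod L)) ≤ C) →
    ∀ (G : Type) [Group G] [TopologicalSpace G] [IsTopologicalGroup G] [CompactSpace G]
      [MeasurableSpace G] [BorelSpace G], IsCompactSimpleLieGroup G →
    ∀ (r : LatticeRep G), ∃ (δ M β₀ c C : ℝ), 0 < δ ∧ 0 < M ∧ 0 < c ∧
      ∀ (L : ℕ) [NeZero L] (β : ℝ), β₀ ≤ β → Real.log (L : ℝ) ≤ β / M →
      ∀ (P : (Fin 4 → ZMod L) → Fin 4 → Fin 4 → GaugeConfig 4 L G → ℝ)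
        (E : (GaugeConfig 4 L G → ℝ) → ℝ),
        (P = fun x i j U => (r.N : ℝ) - (r.ρ (plaquetteHolonomy U x i j)).trace.re) →
        (E = fun F => wilsonExpectation r.ρ β F) →
      ∃ (W : GaugeConfig 4 L G → ℝ), Measurable W ∧ (∀ U, 0 ≤ W U ∧ W U ≤ 1) ∧
        (∀ U, (∀ (z : Fin 4 → ZMod L) (k l : Fin 4), k ≠ l → P z k l U ≤ δ) → W U = 1) ∧
        ∀ (n : ℕ), 1 ≤ n → 8 * n ≤ L →
          c ≤ β ^ 2 * ((n : ℝ) ^ 8 *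
              (E (fun U => P 0 0 1 U * P (Pi.single (2 : Fin 4) ((n : ℕ) : ZMod L)) 0 1 U * W U) / E W -
                E (fun U => P 0 0 1 U * W U) / E W *
                  (E (fun U => P (Pi.single (2 : Fin 4) ((n : ℕ) : ZMod L)) 0 1 U * W U) / E W))) ∧
          β ^ 2 * ((n : ℝ) ^ 8 *
              (E (fun U => P 0 0 1 U * P (Pi.single (2 : Fin 4) ((n : ℕ) : ZMod L)) 0 1 U * W U) / E W -
                E (fun U => P 0 0 1 U * W U) / E W *
                  (E (fun U => P (Pi.single (2 : Fin 4) ((n : ℕ) : ZMod L)) 0 1 U * W U) / E W))) ≤ C := by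
  sorry

/-! ## § The band theorem C⁺ -/

/-- **C⁺ (deep band / frozen coupling)** — verbatim `Ideator2.DeepBandTwoPoint`. For every compact
simple `G` and faithful unitary `r` there are `M, β₀, c, C` with `M, c > 0` such that on EVERY
periodic torus `(ℤ/L)⁴` with `log L ≤ β/M` and `β ≥ β₀`:
`c ≤ β² (n⁸ Cov(P₀^{01}, P_{ne₂}^{01})) ≤ C` for `1 ≤ n ≤ L/8`, and
`β² |Cov(P_x^{ij}, P_y^{i'j'})| dist(x,y)⁸ ≤ C` for `x ≠ y`. No unit map, no shape, no `Λ`. -/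
def DeepBandTwoPoint : Prop :=
  ∀ (G : Type) [Group G] [TopologicalSpace G] [IsTopologicalGroup G] [CompactSpace G],
    IsCompactSimpleLieGroup G →
    letI : MeasurableSpace G := borel G
    haveI : BorelSpace G := ⟨rfl⟩
    ∀ (r : LatticeRep G), ∃ (M β₀ c C : ℝ), 0 < M ∧ 0 < c ∧
      ∀ (L : ℕ) [NeZero L] (β : ℝ), β₀ ≤ β → Real.log (L : ℝ) ≤ β / M →
        let P : (Fin 4 → ZMod L) → Fin 4 → Fin 4 → GaugeConfig 4 L G → ℝ :=
          fun x i j U => (r.N : ℝ) - (r.ρ (plaquetteHolonomy U x i j)).trace.re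
        let E : (GaugeConfig 4 L G → ℝ) → ℝ := fun F => wilsonExpectation (d := 4) (L := L) r.ρ β F
        let cov : (GaugeConfig 4 L G → ℝ) → (GaugeConfig 4 L G → ℝ) → ℝ :=
          fun F F' => E (fun U => F U * F' U) - E F * E F'
        let dist : (Fin 4 → ZMod L) → (Fin 4 → ZMod L) → ℝ :=
          fun x y => Real.sqrt (∑ k : Fin 4, (((x k - y k).valMinAbs : ℤ) : ℝ) ^ 2)
        (∀ n : ℕ, 1 ≤ n → 8 * n ≤ L →
            c ≤ β ^ 2 * ((n : ℝ) ^ 8 * cov (P 0 0 1) (P (Pi.single (2 : Fin 4) ((n : ℕ) : ZMod L)) 0 1)) ∧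
            β ^ 2 * ((n : ℝ) ^ 8 * cov (P 0 0 1) (P (Pi.single (2 : Fin 4) ((n : ℕ) : ZMod L)) 0 1)) ≤ C) ∧
        (∀ (x y : Fin 4 → ZMod L) (i j i' j' : Fin 4), x ≠ y → i ≠ j → i' ≠ j' →
            β ^ 2 * (|cov (P x i j) (P y i' j')| * dist x y ^ 8) ≤ C)

/-! ## § Composition — the four stubs imply C⁺ (real analysis only; no `sorry`) -/

section Composition

/-- Torus distances are at most the side: `dist(x, y) ≤ L`. -/
theorem tdist_le_side {L : ℕ} [NeZero L] (x y : Fin 4 → ZMod L) :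
    Real.sqrt (∑ k : Fin 4, (((x k - y k).valMinAbs : ℤ) : ℝ) ^ 2) ≤ (L : ℝ) := by
  rw [Real.sqrt_le_iff]
  refine ⟨by positivity, ?_⟩
  have hk : ∀ k : Fin 4, (((x k - y k).valMinAbs : ℤ) : ℝ) ^ 2 ≤ ((L : ℝ) / 2) ^ 2 := fun k => by
    have h1 : (((x k - y k).valMinAbs.natAbs : ℕ) : ℝ) ≤ (L : ℝ) / 2 := by
      calc (((x k - y k).valMinAbs.natAbs : ℕ) : ℝ) ≤ ((L / 2 : ℕ) : ℝ) := by
            exact_mod_cast ZMod.natAbs_valMinAbs_le (x k - y k)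
        _ ≤ (L : ℝ) / 2 := Nat.cast_div_le
    have h2 : |(((x k - y k).valMinAbs : ℤ) : ℝ)| = (((x k - y k).valMinAbs.natAbs : ℕ) : ℝ) := by
      rw [← Int.cast_abs, Int.abs_eq_natAbs, Int.cast_natCast]
    have h3 : |(((x k - y k).valMinAbs : ℤ) : ℝ)| ≤ (L : ℝ) / 2 := h2 ▸ h1
    calc (((x k - y k).valMinAbs : ℤ) : ℝ) ^ 2 = |(((x k - y k).valMinAbs : ℤ) : ℝ)| ^ 2 :=
          (sq_abs _).symm
      _ ≤ ((L : ℝ) / 2) ^ 2 := pow_le_pow_left₀ (abs_nonneg _) h3 2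
  calc ∑ k : Fin 4, (((x k - y k).valMinAbs : ℤ) : ℝ) ^ 2 ≤ ∑ _k : Fin 4, ((L : ℝ) / 2) ^ 2 :=
        Finset.sum_le_sum fun k _ => hk k
    _ = (L : ℝ) ^ 2 := by simp; ring

/-- A band torus has side `L ≤ e^{β/M}`, hence `L⁸ ≤ e^{8β/M}`. -/
theorem side_pow_le_exp {L : ℕ} [NeZero L] {β M : ℝ} (hlog : Real.log (L : ℝ) ≤ β / M) :
    ((L : ℝ)) ^ 8 ≤ Real.exp (8 * (β / M)) := by
  have hL0 : (0 : ℝ) < L := Nat.cast_pos.2 (Nat.pos_of_ne_zero (NeZero.ne L))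
  have h1 : (L : ℝ) ≤ Real.exp (β / M) := (Real.log_le_iff_le_exp hL0).1 hlog
  have h2 : Real.exp (β / M) ^ 8 = Real.exp (8 * (β / M)) := by
    rw [← Real.exp_nat_mul]; norm_num
  rw [← h2]
  exact pow_le_pow_left₀ hL0.le h1 8

/-- `|K| β² e^{-aβ} → 0`: a threshold beyond which it is below any `η > 0`. -/
theorem exists_threshold (K : ℝ) {a η : ℝ} (ha : 0 < a) (hη : 0 < η) :
    ∃ T : ℝ, ∀ β : ℝ, T ≤ β → |K| * β ^ 2 * Real.exp (-(a * β)) ≤ η := by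
  have h1 : Tendsto (fun x : ℝ => x ^ 2 * Real.exp (-x)) atTop (𝓝 0) :=
    Real.tendsto_pow_mul_exp_neg_atTop_nhds_zero 2
  have h2 : Tendsto (fun β : ℝ => (a * β) ^ 2 * Real.exp (-(a * β))) atTop (𝓝 0) :=
    h1.comp (tendsto_id.const_mul_atTop ha)
  have h3 : Tendsto (fun β : ℝ => |K| / a ^ 2 * ((a * β) ^ 2 * Real.exp (-(a * β)))) atTop
      (𝓝 0) := by
    simpa using h2.const_mul (|K| / a ^ 2)
  have h4 : ∀ᶠ β : ℝ in atTop, |K| / a ^ 2 * ((a * β) ^ 2 * Real.exp (-(a * β))) < η :=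
    h3 (Iio_mem_nhds hη)
  obtain ⟨T, hT⟩ := Filter.eventually_atTop.1 h4
  refine ⟨T, fun β hβ => ?_⟩
  have h5 := hT β hβ
  have e : |K| / a ^ 2 * ((a * β) ^ 2 * Real.exp (-(a * β))) = |K| * β ^ 2 * Real.exp (-(a * β)) := by
    have ha2 : a ^ 2 ≠ 0 := by positivity
    field_simp
  rw [e] at h5
  exact h5.le

/-- The deleted stratum is invisible at the precision of the two-sided axis clause. -/
theorem axis_transfer {A B ε a b c C : ℝ} (ha : 0 ≤ a) (hb : 0 ≤ b) (hAB : |A - B| ≤ ε)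
    (hlo : c ≤ a * (b * B)) (hhi : a * (b * B) ≤ C) (hε : a * b * ε ≤ c / 2) :
    c / 2 ≤ a * (b * A) ∧ a * (b * A) ≤ C + c / 2 := by
  have h1 : A - B ≤ ε := (abs_le.1 hAB).2
  have h2 : -ε ≤ A - B := (abs_le.1 hAB).1
  have hab : 0 ≤ a * b := mul_nonneg ha hb
  have e : a * (b * A) = a * (b * B) + a * b * (A - B) := by ring
  have h3 : a * b * -ε ≤ a * b * (A - B) := mul_le_mul_of_nonneg_left h2 hab
  have h4 : a * b * (A - B) ≤ a * b * ε := mul_le_mul_of_nonneg_left h1 hab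
  constructor
  · rw [e]; nlinarith
  · rw [e]; nlinarith

/-- The deleted stratum is invisible at the precision of the all-pairs clause. -/
theorem allpairs_transfer {A B ε a d D C e : ℝ} (ha : 0 ≤ a) (hd : 0 ≤ d) (hdD : d ≤ D)
    (hAB : |A - B| ≤ ε) (hB : a * (|B| * d ^ 8) ≤ C) (hε : a * D ^ 8 * ε ≤ e) :
    a * (|A| * d ^ 8) ≤ C + e := by
  have h1 : |A| ≤ |B| + ε := by
    calc |A| = |B + (A - B)| := by ring_nf
      _ ≤ |B| + |A - B| := abs_add_le _ _
      _ ≤ |B| + ε := by linarith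
  have hd8 : 0 ≤ d ^ 8 := by positivity
  have hdD8 : d ^ 8 ≤ D ^ 8 := pow_le_pow_left₀ hd hdD 8
  have hε0 : 0 ≤ ε := le_trans (abs_nonneg _) hAB
  have h2 : a * (|A| * d ^ 8) ≤ a * ((|B| + ε) * d ^ 8) :=
    mul_le_mul_of_nonneg_left (mul_le_mul_of_nonneg_right h1 hd8) ha
  have h3 : a * d ^ 8 * ε ≤ a * D ^ 8 * ε :=
    mul_le_mul_of_nonneg_right (mul_le_mul_of_nonneg_left hdD8 ha) hε0
  calc a * (|A| * d ^ 8) ≤ a * ((|B| + ε) * d ^ 8) := h2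
    _ = a * (|B| * d ^ 8) + a * d ^ 8 * ε := by ring
    _ ≤ C + a * D ^ 8 * ε := by linarith
    _ ≤ C + e := by linarith

/-- The error budget of the band: with `16/c₁ ≤ M`, `0 ≤ β` and `|K| β² e^{-c₁β/2} ≤ η`,
`β² · L⁸ · K e^{-c₁β} ≤ η` on every band torus (`L⁸ ≤ e^{8β/M} ≤ e^{c₁β/2} · e^{…}`). -/
theorem budget {L : ℕ} [NeZero L] {β M c₁ K η : ℝ} (hc₁ : 0 < c₁) (hM : 16 / c₁ ≤ M)
    (hβ : 0 ≤ β) (hlog : Real.log (L : ℝ) ≤ β / M) (hK0 : 0 ≤ K * Real.exp (-(c₁ * β)))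
    (hT : |K| * β ^ 2 * Real.exp (-(c₁ / 2 * β)) ≤ η) :
    β ^ 2 * (L : ℝ) ^ 8 * (K * Real.exp (-(c₁ * β))) ≤ η := by
  have hL8 : ((L : ℝ)) ^ 8 ≤ Real.exp (8 * (β / M)) := side_pow_le_exp hlog
  have h8M : 8 * (β / M) ≤ c₁ / 2 * β := by
    have h1 : β / M ≤ β / (16 / c₁) := div_le_div_of_nonneg_left hβ (by positivity) hM
    have h2 : β / (16 / c₁) = c₁ * β / 16 := by
      field_simp
    rw [h2] at h1
    nlinarith
  have hexp : Real.exp (8 * (β / M)) * Real.exp (-(c₁ * β)) ≤ Real.exp (-(c₁ / 2 * β)) := by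
    rw [← Real.exp_add]
    exact Real.exp_le_exp.2 (by linarith)
  have hK : K * Real.exp (-(c₁ * β)) ≤ |K| * Real.exp (-(c₁ * β)) :=
    mul_le_mul_of_nonneg_right (le_abs_self K) (Real.exp_pos _).le
  calc β ^ 2 * (L : ℝ) ^ 8 * (K * Real.exp (-(c₁ * β)))
      ≤ β ^ 2 * Real.exp (8 * (β / M)) * (K * Real.exp (-(c₁ * β))) :=
        mul_le_mul_of_nonneg_right (mul_le_mul_of_nonneg_left hL8 (sq_nonneg β)) hK0
    _ ≤ β ^ 2 * Real.exp (8 * (β / M)) * (|K| * Real.exp (-(c₁ * β))) :=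
        mul_le_mul_of_nonneg_left hK (by positivity)
    _ = |K| * β ^ 2 * (Real.exp (8 * (β / M)) * Real.exp (-(c₁ * β))) := by ring
    _ ≤ |K| * β ^ 2 * Real.exp (-(c₁ / 2 * β)) :=
        mul_le_mul_of_nonneg_left hexp (by positivity)
    _ ≤ η := hT

/-- **Composition.** The four stubs imply the band theorem C⁺: engine outputs S₃, S₄ (the latter
fed with the kernel band S₂) give the clauses for regulated measures `W`, `W'`; the deletion S₁
compares each with Wilson's measure at cost `K e^{-c₁β}`; on a band torus with `M ≥ 16/c₁` this
cost times `β² L⁸ ≤ β² e^{8β/M}` is `≤ |K| β² e^{-c₁β/2} ≤ c₄/2` beyond a threshold, so the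
constants of C⁺ are `c = c₄/2`, `C = max C₃ C₄ + c₄/2`. -/
theorem deepBand_of_stubs
    (h₁ : ∀ (G : Type) [Group G] [TopologicalSpace G] [IsTopologicalGroup G] [CompactSpace G]
        [MeasurableSpace G] [BorelSpace G], IsCompactSimpleLieGroup G →
      ∀ (r : LatticeRep G) (δ : ℝ), 0 < δ →
      ∃ (M₁ β₁ K c₁ : ℝ), 0 < M₁ ∧ 0 < c₁ ∧
        ∀ (L : ℕ) [NeZero L] (β : ℝ), β₁ ≤ β → Real.log (L : ℝ) ≤ β / M₁ →
        ∀ (P : (Fin 4 → ZMod L) → Fin 4 → Fin 4 → GaugeConfig 4 L G → ℝ)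
          (E : (GaugeConfig 4 L G → ℝ) → ℝ),
          (P = fun x i j U => (r.N : ℝ) - (r.ρ (plaquetteHolonomy U x i j)).trace.re) →
          (E = fun F => wilsonExpectation r.ρ β F) →
        ∀ (W : GaugeConfig 4 L G → ℝ), Measurable W → (∀ U, 0 ≤ W U ∧ W U ≤ 1) →
          (∀ U, (∀ (z : Fin 4 → ZMod L) (k l : Fin 4), k ≠ l → P z k l U ≤ δ) → W U = 1) →
        ∀ (x y : Fin 4 → ZMod L) (i j i' j' : Fin 4),
          |(E (fun U => P x i j U * P y i' j' U) - E (P x i j) * E (P y i' j')) -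
              (E (fun U => P x i j U * P y i' j' U * W U) / E W -
                E (fun U => P x i j U * W U) / E W * (E (fun U => P y i' j' U * W U) / E W))|
            ≤ K * Real.exp (-(c₁ * β)))
    (h₂ : ∃ (c C : ℝ), 0 < c ∧ ∀ (L : ℕ) [NeZero L] (e₀ e₁ : Fin 4 → ZMod L) (K : (Fin 4 → ZMod L) → ℝ),
        e₀ = Pi.single (0 : Fin 4) (1 : ZMod L) → e₁ = Pi.single (1 : Fin 4) (1 : ZMod L) →
        (K = fun z =>
          ((2 * Literature.Probability.LatticeModels.torusGreen z
              - Literature.Probability.LatticeModels.torusGreen (z + e₀)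
              - Literature.Probability.LatticeModels.torusGreen (z - e₀))
            + (2 * Literature.Probability.LatticeModels.torusGreen z
              - Literature.Probability.LatticeModels.torusGreen (z + e₁)
              - Literature.Probability.LatticeModels.torusGreen (z - e₁))) / 2) →
        ∀ (n : ℕ), 1 ≤ n → 8 * n ≤ L →
          c ≤ (n : ℝ) ^ 4 * K (Pi.single (2 : Fin 4) ((n : ℕ) : ZMod L)) ∧
            (n : ℝ) ^ 4 * K (Pi.single (2 : Fin 4) ((n : ℕ) : ZMod L)) ≤ C)
    (h₃ : ∀ (G : Type) [Group G] [TopologicalSpace G] [IsTopologicalGroup G] [CompactSpace G]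
        [MeasurableSpace G] [BorelSpace G], IsCompactSimpleLieGroup G →
      ∀ (r : LatticeRep G), ∃ (δ M β₀ C : ℝ), 0 < δ ∧ 0 < M ∧
        ∀ (L : ℕ) [NeZero L] (β : ℝ), β₀ ≤ β → Real.log (L : ℝ) ≤ β / M →
        ∀ (P : (Fin 4 → ZMod L) → Fin 4 → Fin 4 → GaugeConfig 4 L G → ℝ)
          (E : (GaugeConfig 4 L G → ℝ) → ℝ),
          (P = fun x i j U => (r.N : ℝ) - (r.ρ (plaquetteHolonomy U x i j)).trace.re) →
          (E = fun F => wilsonExpectation r.ρ β F) →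
        ∃ (W : GaugeConfig 4 L G → ℝ), Measurable W ∧ (∀ U, 0 ≤ W U ∧ W U ≤ 1) ∧
          (∀ U, (∀ (z : Fin 4 → ZMod L) (k l : Fin 4), k ≠ l → P z k l U ≤ δ) → W U = 1) ∧
          ∀ (x y : Fin 4 → ZMod L) (i j i' j' : Fin 4), x ≠ y → i ≠ j → i' ≠ j' →
            β ^ 2 * (|E (fun U => P x i j U * P y i' j' U * W U) / E W -
                  E (fun U => P x i j U * W U) / E W * (E (fun U => P y i' j' U * W U) / E W)|
                * Real.sqrt (∑ k : Fin 4, (((x k - y k).valMinAbs : ℤ) : ℝ) ^ 2) ^ 8) ≤ C)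
    (h₄ : (∃ (c C : ℝ), 0 < c ∧ ∀ (L : ℕ) [NeZero L] (e₀ e₁ : Fin 4 → ZMod L) (K : (Fin 4 → ZMod L) → ℝ),
        e₀ = Pi.single (0 : Fin 4) (1 : ZMod L) → e₁ = Pi.single (1 : Fin 4) (1 : ZMod L) →
        (K = fun z =>
          ((2 * Literature.Probability.LatticeModels.torusGreen z
              - Literature.Probability.LatticeModels.torusGreen (z + e₀)
              - Literature.Probability.LatticeModels.torusGreen (z - e₀))
            + (2 * Literature.Probability.LatticeModels.torusGreen z
              - Literature.Probability.LatticeModels.torusGreen (z + e₁)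
              - Literature.Probability.LatticeModels.torusGreen (z - e₁))) / 2) →
        ∀ (n : ℕ), 1 ≤ n → 8 * n ≤ L →
          c ≤ (n : ℝ) ^ 4 * K (Pi.single (2 : Fin 4) ((n : ℕ) : ZMod L)) ∧
            (n : ℝ) ^ 4 * K (Pi.single (2 : Fin 4) ((n : ℕ) : ZMod L)) ≤ C) →
      ∀ (G : Type) [Group G] [TopologicalSpace G] [IsTopologicalGroup G] [CompactSpace G]
        [MeasurableSpace G] [BorelSpace G], IsCompactSimpleLieGroup G →
      ∀ (r : LatticeRep G), ∃ (δ M β₀ c C : ℝ), 0 < δ ∧ 0 < M ∧ 0 < c ∧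
        ∀ (L : ℕ) [NeZero L] (β : ℝ), β₀ ≤ β → Real.log (L : ℝ) ≤ β / M →
        ∀ (P : (Fin 4 → ZMod L) → Fin 4 → Fin 4 → GaugeConfig 4 L G → ℝ)
          (E : (GaugeConfig 4 L G → ℝ) → ℝ),
          (P = fun x i j U => (r.N : ℝ) - (r.ρ (plaquetteHolonomy U x i j)).trace.re) →
          (E = fun F => wilsonExpectation r.ρ β F) →
        ∃ (W : GaugeConfig 4 L G → ℝ), Measurable W ∧ (∀ U, 0 ≤ W U ∧ W U ≤ 1) ∧
          (∀ U, (∀ (z : Fin 4 → ZMod L) (k l : Fin 4), k ≠ l → P z k l U ≤ δ) → W U = 1) ∧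
          ∀ (n : ℕ), 1 ≤ n → 8 * n ≤ L →
            c ≤ β ^ 2 * ((n : ℝ) ^ 8 *
                (E (fun U => P 0 0 1 U * P (Pi.single (2 : Fin 4) ((n : ℕ) : ZMod L)) 0 1 U * W U) / E W -
                  E (fun U => P 0 0 1 U * W U) / E W *
                    (E (fun U => P (Pi.single (2 : Fin 4) ((n : ℕ) : ZMod L)) 0 1 U * W U) / E W))) ∧
            β ^ 2 * ((n : ℝ) ^ 8 *
                (E (fun U => P 0 0 1 U * P (Pi.single (2 : Fin 4) ((n : ℕ) : ZMod L)) 0 1 U * W U) / E W -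
                  E (fun U => P 0 0 1 U * W U) / E W *
                    (E (fun U => P (Pi.single (2 : Fin 4) ((n : ℕ) : ZMod L)) 0 1 U * W U) / E W))) ≤ C) :
    DeepBandTwoPoint := by
  intro G _ _ _ _ hG
  letI : MeasurableSpace G := borel G
  haveI : BorelSpace G := ⟨rfl⟩
  intro r
  -- engine outputs on regulated measures
  obtain ⟨δ₃, M₃, β₃, C₃, hδ₃, hM₃, H₃⟩ := h₃ G hG r
  obtain ⟨δ₄, M₄, β₄, c₄, C₄, hδ₄, hM₄, hc₄, H₄⟩ := h₄ h₂ G hG r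
  -- large-field deletion at the two body widths
  obtain ⟨M₁, β₁, K₁, c₁, hM₁, hc₁, H₁⟩ := h₁ G hG r δ₄ hδ₄
  obtain ⟨M₁', β₁', K₁', c₁', hM₁', hc₁', H₁'⟩ := h₁ G hG r δ₃ hδ₃
  -- thresholds making the deleted stratum invisible at precision c₄/2
  obtain ⟨T, hT⟩ := exists_threshold K₁ (half_pos hc₁) (half_pos hc₄)
  obtain ⟨T', hT'⟩ := exists_threshold K₁' (half_pos hc₁') (half_pos hc₄)
  -- the constants of C⁺
  obtain ⟨M, hM⟩ : ∃ M : ℝ,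
      max (max (max M₃ M₄) (max M₁ M₁')) (max (16 / c₁) (16 / c₁')) ≤ M := ⟨_, le_rfl⟩
  obtain ⟨B, hB⟩ : ∃ B : ℝ,
      max (max (max β₃ β₄) (max β₁ β₁')) (max (max T T') 0) ≤ B := ⟨_, le_rfl⟩
  simp only [max_le_iff] at hM hB
  obtain ⟨⟨⟨hM3, hM4⟩, hM1, hM1'⟩, hM16, hM16'⟩ := hM
  obtain ⟨⟨⟨hB3, hB4⟩, hB1, hB1'⟩, ⟨hBT, hBT'⟩, hB0⟩ := hB
  have hMpos : 0 < M := lt_of_lt_of_le hM₃ hM3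
  refine ⟨M, B, c₄ / 2, max C₃ C₄ + c₄ / 2, hMpos, half_pos hc₄, ?_⟩
  intro L _ β hβ hlog P E cov dist
  have hβ0 : 0 ≤ β := le_trans hB0 hβ
  have band : ∀ {M' : ℝ}, 0 < M' → M' ≤ M → Real.log (L : ℝ) ≤ β / M' := fun hM' hle =>
    hlog.trans (div_le_div_of_nonneg_left hβ0 hM' hle)
  have hdL : ∀ x y : Fin 4 → ZMod L, dist x y ≤ (L : ℝ) := fun x y => tdist_le_side x y
  refine ⟨fun n hn h8 => ?_, fun x y i j i' j' hxy hij hij' => ?_⟩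
  · -- axis clause: engine S₄ on W, deletion S₁ at δ₄
    obtain ⟨W, hWm, hW01, hWb, hW⟩ := H₄ L β (le_trans hB4 hβ) (band hM₄ hM4) P E rfl rfl
    obtain ⟨hlo, hhi⟩ := hW n hn h8
    have hD :
        |cov (P 0 0 1) (P (Pi.single (2 : Fin 4) ((n : ℕ) : ZMod L)) 0 1) -
          (E (fun U => P 0 0 1 U * P (Pi.single (2 : Fin 4) ((n : ℕ) : ZMod L)) 0 1 U * W U) / E W -
            E (fun U => P 0 0 1 U * W U) / E W *
              (E (fun U => P (Pi.single (2 : Fin 4) ((n : ℕ) : ZMod L)) 0 1 U * W U) / E W))|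
          ≤ K₁ * Real.exp (-(c₁ * β)) :=
      H₁ L β (le_trans hB1 hβ) (band hM₁ hM1) P E rfl rfl W hWm hW01 hWb 0
        (Pi.single (2 : Fin 4) ((n : ℕ) : ZMod L)) 0 1 0 1
    have hn8 : ((n : ℝ)) ^ 8 ≤ ((L : ℝ)) ^ 8 := by
      have : (n : ℝ) ≤ (L : ℝ) := by exact_mod_cast (le_trans (by omega : n ≤ 8 * n) h8)
      exact pow_le_pow_left₀ (by positivity) this 8
    have hε0 : 0 ≤ K₁ * Real.exp (-(c₁ * β)) := le_trans (abs_nonneg _) hD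
    have hbud : β ^ 2 * (L : ℝ) ^ 8 * (K₁ * Real.exp (-(c₁ * β))) ≤ c₄ / 2 :=
      budget hc₁ hM16 hβ0 hlog hε0 (hT β (le_trans hBT hβ))
    have hsmall : β ^ 2 * (n : ℝ) ^ 8 * (K₁ * Real.exp (-(c₁ * β))) ≤ c₄ / 2 :=
      le_trans (mul_le_mul_of_nonneg_right
        (mul_le_mul_of_nonneg_left hn8 (by positivity)) hε0) hbud
    obtain ⟨h_lo, h_hi⟩ := axis_transfer (by positivity) (by positivity) hD hlo hhi hsmall
    exact ⟨h_lo, h_hi.trans (by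
      have := le_max_right C₃ C₄
      linarith)⟩
  · -- all-pairs clause: engine S₃ on W', deletion S₁ at δ₃
    obtain ⟨W, hWm, hW01, hWb, hW⟩ := H₃ L β (le_trans hB3 hβ) (band hM₃ hM3) P E rfl rfl
    have hup := hW x y i j i' j' hxy hij hij'
    have hD :
        |cov (P x i j) (P y i' j') -
          (E (fun U => P x i j U * P y i' j' U * W U) / E W -
            E (fun U => P x i j U * W U) / E W * (E (fun U => P y i' j' U * W U) / E W))|
          ≤ K₁' * Real.exp (-(c₁' * β)) :=
      H₁' L β (le_trans hB1' hβ) (band hM₁' hM1') P E rfl rfl W hWm hW01 hWb x y i j i' j'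
    have hε0 : 0 ≤ K₁' * Real.exp (-(c₁' * β)) := le_trans (abs_nonneg _) hD
    have hbud : β ^ 2 * (L : ℝ) ^ 8 * (K₁' * Real.exp (-(c₁' * β))) ≤ c₄ / 2 :=
      budget hc₁' hM16' hβ0 hlog hε0 (hT' β (le_trans hBT' hβ))
    have hfin := allpairs_transfer (by positivity) (Real.sqrt_nonneg _) (hdL x y) hD hup hbud
    calc β ^ 2 * (|cov (P x i j) (P y i' j')| * dist x y ^ 8) ≤ C₃ + c₄ / 2 := hfin
      _ ≤ max C₃ C₄ + c₄ / 2 := by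
        have := le_max_left C₃ C₄
        linarith

end Composition

/-! ## § Remarks (proved) -/

/-- **Rung relation (triage r1-3, sharpening 3).** C⁺ implies the fixed-torus rung of card
`generic-step-gamma-encoding` with UNIFORM constants: `c, C` depend on `(G, r)` only, and on the
torus of side `L` both clauses hold in bare units for all `β ≥ B(L) := max β₀ (M log L)`. So the
two encoding cards are two rungs (per-torus limit / `L`-uniform band) of one line. -/
theorem fixedTorus_of_deepBand (hC : DeepBandTwoPoint) :
    ∀ (G : Type) [Group G] [TopologicalSpace G] [IsTopologicalGroup G] [CompactSpace G],
      IsCompactSimpleLieGroup G →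
      letI : MeasurableSpace G := borel G
      haveI : BorelSpace G := ⟨rfl⟩
      ∀ (r : LatticeRep G), ∃ (c C : ℝ), 0 < c ∧
        ∀ (L : ℕ) [NeZero L], ∃ B : ℝ, ∀ (β : ℝ), B ≤ β →
        let P : (Fin 4 → ZMod L) → Fin 4 → Fin 4 → GaugeConfig 4 L G → ℝ :=
          fun x i j U => (r.N : ℝ) - (r.ρ (plaquetteHolonomy U x i j)).trace.re
        let E : (GaugeConfig 4 L G → ℝ) → ℝ := fun F => wilsonExpectation (d := 4) (L := L) r.ρ β F
        let cov : (GaugeConfig 4 L G → ℝ) → (GaugeConfig 4 L G → ℝ) → ℝ :=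
          fun F F' => E (fun U => F U * F' U) - E F * E F'
        let dist : (Fin 4 → ZMod L) → (Fin 4 → ZMod L) → ℝ :=
          fun x y => Real.sqrt (∑ k : Fin 4, (((x k - y k).valMinAbs : ℤ) : ℝ) ^ 2)
        (∀ n : ℕ, 1 ≤ n → 8 * n ≤ L →
            c ≤ β ^ 2 * ((n : ℝ) ^ 8 * cov (P 0 0 1) (P (Pi.single (2 : Fin 4) ((n : ℕ) : ZMod L)) 0 1)) ∧
            β ^ 2 * ((n : ℝ) ^ 8 * cov (P 0 0 1) (P (Pi.single (2 : Fin 4) ((n : ℕ) : ZMod L)) 0 1)) ≤ C) ∧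
        (∀ (x y : Fin 4 → ZMod L) (i j i' j' : Fin 4), x ≠ y → i ≠ j → i' ≠ j' →
            β ^ 2 * (|cov (P x i j) (P y i' j')| * dist x y ^ 8) ≤ C) := by
  intro G _ _ _ _ hG r
  obtain ⟨M, β₀, c, C, hM, hc, H⟩ := hC G hG r
  refine ⟨c, C, hc, fun L _ => ⟨max β₀ (M * Real.log L), fun β hβ => ?_⟩⟩
  have hβ0 : β₀ ≤ β := (le_max_left _ _).trans hβ
  have hlog : Real.log L ≤ β / M := by
    rw [le_div_iff₀ hM]
    have := (le_max_right _ _).trans hβ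
    linarith
  exact H L β hβ0 hlog

/-! ## § Encoding — C⁺ ⇒ crux (generic-step unit map; pure real analysis, adapted verbatim from
`Cruxes/FemtoCurvatureTwoPoint/SketchIdeator2.lean`, ideator 2, where it is kernel-certified) -/

section Encoding


/-- Step index `k(β) = ⌊log₂ ⌊β⌋₊⌋`, so that `2^k ≤ β < 2^{k+1}` for `β ≥ 1`. -/
noncomputable def stepIdx (β : ℝ) : ℕ := Nat.log 2 ⌊β⌋₊

/-- The step unit map `a(β) = e^{-2^{k(β)}/M'}`. -/
noncomputable def aEnc (M' β : ℝ) : ℝ := Real.exp (-(2 : ℝ) ^ stepIdx β / M')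

open Classical in
/-- The encoded shape: `Γ(√m · e^{-2^k/M'}) = 4^{-k}` on the level sets (`m ≥ 1`), `Γ = 1`
elsewhere; well defined once the level sets of distinct steps are disjoint (genericity of `M'`). -/
noncomputable def gammaEnc (M' s : ℝ) : ℝ :=
  if h : ∃ k m : ℕ, 1 ≤ m ∧ s = Real.sqrt m * Real.exp (-(2 : ℝ) ^ k / M')
    then ((4 : ℝ) ^ (Classical.choose h))⁻¹ else 1

theorem two_pow_stepIdx_le {β : ℝ} (hβ : 1 ≤ β) : (2 : ℝ) ^ stepIdx β ≤ β := by
  have hfl : ⌊β⌋₊ ≠ 0 := (Nat.floor_pos.2 hβ).ne'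
  have h1 : 2 ^ Nat.log 2 ⌊β⌋₊ ≤ ⌊β⌋₊ := Nat.pow_log_le_self 2 hfl
  have h2 : ((2 ^ Nat.log 2 ⌊β⌋₊ : ℕ) : ℝ) ≤ (⌊β⌋₊ : ℝ) := by exact_mod_cast h1
  have h3 : (⌊β⌋₊ : ℝ) ≤ β := Nat.floor_le (by linarith)
  have h4 : ((2 ^ Nat.log 2 ⌊β⌋₊ : ℕ) : ℝ) = (2 : ℝ) ^ stepIdx β := by
    rw [stepIdx]; push_cast; ring
  rw [← h4]
  exact h2.trans h3

theorem lt_two_pow_stepIdx_succ (β : ℝ) : β < (2 : ℝ) ^ (stepIdx β + 1) := by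
  have h1 : ⌊β⌋₊ < 2 ^ (Nat.log 2 ⌊β⌋₊ + 1) := Nat.lt_pow_succ_log_self (by norm_num) ⌊β⌋₊
  have h2 : ⌊β⌋₊ + 1 ≤ 2 ^ (Nat.log 2 ⌊β⌋₊ + 1) := h1
  have h3 : ((⌊β⌋₊ + 1 : ℕ) : ℝ) ≤ ((2 ^ (Nat.log 2 ⌊β⌋₊ + 1) : ℕ) : ℝ) := by exact_mod_cast h2
  have h4 : β < (⌊β⌋₊ : ℝ) + 1 := Nat.lt_floor_add_one β
  calc β < (⌊β⌋₊ : ℝ) + 1 := h4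
    _ = ((⌊β⌋₊ + 1 : ℕ) : ℝ) := by push_cast; ring
    _ ≤ ((2 ^ (Nat.log 2 ⌊β⌋₊ + 1) : ℕ) : ℝ) := h3
    _ = (2 : ℝ) ^ (stepIdx β + 1) := by rw [stepIdx]; push_cast; ring

theorem aEnc_pos (M' β : ℝ) : 0 < aEnc M' β := Real.exp_pos _

theorem tendsto_aEnc {M' : ℝ} (hM' : 0 < M') : Tendsto (aEnc M') atTop (𝓝 0) := by
  have h1 : Tendsto (fun β : ℝ => -β * (1 / (2 * M'))) atTop atBot :=
    tendsto_neg_atTop_atBot.atBot_mul_const (by positivity)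
  have h2 : Tendsto (fun β : ℝ => Real.exp (-β * (1 / (2 * M')))) atTop (𝓝 0) :=
    Real.tendsto_exp_atBot.comp h1
  refine tendsto_of_tendsto_of_tendsto_of_le_of_le tendsto_const_nhds h2
    (fun β => (aEnc_pos M' β).le) fun β => ?_
  show Real.exp (-(2 : ℝ) ^ stepIdx β / M') ≤ Real.exp (-β * (1 / (2 * M')))
  apply Real.exp_le_exp.2
  have hlt := lt_two_pow_stepIdx_succ β
  rw [pow_succ] at hlt
  have hk : β ≤ 2 * (2 : ℝ) ^ stepIdx β := by linarith
  have e : -(2 : ℝ) ^ stepIdx β / M' = -(2 * (2 : ℝ) ^ stepIdx β) * (1 / (2 * M')) := by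
    ring
  rw [e]
  exact mul_le_mul_of_nonneg_right (by linarith) (by positivity)

theorem gammaEnc_pos (M' s : ℝ) : 0 < gammaEnc M' s := by
  unfold gammaEnc; split_ifs <;> positivity

theorem gammaEnc_le_one (M' s : ℝ) : gammaEnc M' s ≤ 1 := by
  unfold gammaEnc
  split_ifs
  · exact inv_le_one_of_one_le₀ (one_le_pow₀ (by norm_num))
  · exact le_rfl

/-- On a level set `s = √m · e^{-2^k/M'}` the encoded shape is `4^{-k}`, provided the level sets
of distinct steps are disjoint. -/
theorem gammaEnc_eq {M' : ℝ}
    (hgen : ∀ (k k' m m' : ℕ), k ≠ k' → 1 ≤ m → 1 ≤ m' →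
      Real.sqrt m * Real.exp (-(2 : ℝ) ^ k / M') ≠ Real.sqrt m' * Real.exp (-(2 : ℝ) ^ k' / M'))
    (k m : ℕ) (hm : 1 ≤ m) :
    gammaEnc M' (Real.sqrt m * Real.exp (-(2 : ℝ) ^ k / M')) = ((4 : ℝ) ^ k)⁻¹ := by
  have h : ∃ k' m' : ℕ, 1 ≤ m' ∧ Real.sqrt m * Real.exp (-(2 : ℝ) ^ k / M') =
      Real.sqrt m' * Real.exp (-(2 : ℝ) ^ k' / M') := ⟨k, m, hm, rfl⟩
  unfold gammaEnc
  rw [dif_pos h]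
  obtain ⟨m', hm', heq⟩ := Classical.choose_spec h
  have hk : Classical.choose h = k := by
    by_contra hne
    exact hgen k (Classical.choose h) m m' (Ne.symm hne) hm hm' heq
  rw [hk]

/-- **Genericity of the band parameter.** For `M > 0` there is `M' ≥ M` such that the level
sets `{√m · e^{-2^k/M'} : m ≥ 1}` of distinct steps `k ≠ k'` are disjoint: the bad `M'` form a
countable set (one value per `(k, k', m, m')`), and `[M, M+1]` has positive Lebesgue measure. -/
theorem exists_generic {M : ℝ} (hM : 0 < M) :
    ∃ M' : ℝ, M ≤ M' ∧ ∀ (k k' m m' : ℕ), k ≠ k' → 1 ≤ m → 1 ≤ m' →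
      Real.sqrt m * Real.exp (-(2 : ℝ) ^ k / M') ≠ Real.sqrt m' * Real.exp (-(2 : ℝ) ^ k' / M') := by
  classical
  let B : Set ℝ := ⋃ k : ℕ, ⋃ k' : ℕ, ⋃ m : ℕ, ⋃ m' : ℕ,
    {t : ℝ | k ≠ k' ∧ 1 ≤ m ∧ 1 ≤ m' ∧ t ≠ 0 ∧
      Real.sqrt m * Real.exp (-(2 : ℝ) ^ k / t) = Real.sqrt m' * Real.exp (-(2 : ℝ) ^ k' / t)}
  have key : ∀ (k k' m m' : ℕ) (s : ℝ), 1 ≤ m → 1 ≤ m' → s ≠ 0 →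
      Real.sqrt m * Real.exp (-(2 : ℝ) ^ k / s) = Real.sqrt m' * Real.exp (-(2 : ℝ) ^ k' / s) →
      ((2 : ℝ) ^ k' - (2 : ℝ) ^ k) / s = Real.log (Real.sqrt m' / Real.sqrt m) := by
    intro k k' m m' s hm hm' hs h
    have hm0 : 0 < Real.sqrt m := Real.sqrt_pos.2 (by exact_mod_cast hm)
    have hm0' : 0 < Real.sqrt m' := Real.sqrt_pos.2 (by exact_mod_cast hm')
    have hexp : Real.exp (((2 : ℝ) ^ k' - (2 : ℝ) ^ k) / s) = Real.sqrt m' / Real.sqrt m := by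
      have e1 : ((2 : ℝ) ^ k' - (2 : ℝ) ^ k) / s = (-(2 : ℝ) ^ k / s) - (-(2 : ℝ) ^ k' / s) := by
        ring
      rw [e1, Real.exp_sub, div_eq_div_iff (Real.exp_pos _).ne' hm0.ne', mul_comm]
      exact h
    have hl := congrArg Real.log hexp
    rwa [Real.log_exp] at hl
  have hcount : B.Countable := by
    refine Set.countable_iUnion fun k => Set.countable_iUnion fun k' =>
      Set.countable_iUnion fun m => Set.countable_iUnion fun m' => Set.Subsingleton.countable ?_
    intro t ht u hu
    obtain ⟨hkk, hm, hm', ht0, hteq⟩ := ht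
    obtain ⟨-, -, -, hu0, hueq⟩ := hu
    have e1 := key k k' m m' t hm hm' ht0 hteq
    have e2 := key k k' m m' u hm hm' hu0 hueq
    have hD : (2 : ℝ) ^ k' - (2 : ℝ) ^ k ≠ 0 := by
      intro h0
      have h1 : (2 : ℝ) ^ k' = (2 : ℝ) ^ k := by linarith
      have h2 : (2 : ℕ) ^ k' = 2 ^ k := by exact_mod_cast h1
      exact hkk (Nat.pow_right_injective le_rfl h2).symm
    have e3 : ((2 : ℝ) ^ k' - (2 : ℝ) ^ k) / t = ((2 : ℝ) ^ k' - (2 : ℝ) ^ k) / u := by rw [e1, e2]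
    rw [div_eq_div_iff ht0 hu0] at e3
    exact (mul_left_cancel₀ hD e3).symm
  have hB0 : volume B = 0 := hcount.measure_zero volume
  have hIcc : volume (Set.Icc M (M + 1)) ≠ 0 := by
    rw [Real.volume_Icc]; simp
  have hns : ¬ Set.Icc M (M + 1) ⊆ B := fun hsub => hIcc (measure_mono_null hsub hB0)
  obtain ⟨M', hM'I, hM'B⟩ := Set.not_subset.1 hns
  refine ⟨M', hM'I.1, fun k k' m m' hkk hm hm' heq => hM'B ?_⟩
  have hM'0 : M' ≠ 0 := by
    have : 0 < M' := hM.trans_le hM'I.1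
    exact this.ne'
  simp only [B, Set.mem_iUnion, Set.mem_setOf_eq]
  exact ⟨k, k', m, m', hkk, hm, hm', hM'0, heq⟩

/-- Arithmetic of one step: `2^k ≤ β < 2^{k+1}` turns `[c, C]·β⁻²` into `[(c/4)4^{-k}, |C|4^{-k}]`. -/
theorem band_to_levels {β c C Y : ℝ} {k : ℕ} (h2k : (2 : ℝ) ^ k ≤ β) (hβlt : β < (2 : ℝ) ^ (k + 1))
    (hc : 0 < c) (h_lo : c ≤ β ^ 2 * Y) (h_hi : β ^ 2 * Y ≤ C) :
    c / 4 * ((4 : ℝ) ^ k)⁻¹ ≤ Y ∧ Y ≤ |C| * ((4 : ℝ) ^ k)⁻¹ := by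
  have h2kpos : 0 < (2 : ℝ) ^ k := by positivity
  have hβpos : 0 < β := h2kpos.trans_le h2k
  have hβ2 : 0 < β ^ 2 := by positivity
  have h4k : (4 : ℝ) ^ k = ((2 : ℝ) ^ k) ^ 2 := by
    rw [show (4 : ℝ) = 2 ^ 2 by norm_num, ← pow_mul, mul_comm, pow_mul]
  have h4k1 : (4 : ℝ) ^ (k + 1) = ((2 : ℝ) ^ (k + 1)) ^ 2 := by
    rw [show (4 : ℝ) = 2 ^ 2 by norm_num, ← pow_mul, mul_comm, pow_mul]
  have hle : (4 : ℝ) ^ k ≤ β ^ 2 := by rw [h4k]; exact pow_le_pow_left₀ h2kpos.le h2k 2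
  have hlt : β ^ 2 ≤ (4 : ℝ) ^ (k + 1) := by
    rw [h4k1]; exact (pow_lt_pow_left₀ hβlt hβpos.le two_ne_zero).le
  have h4pos : 0 < (4 : ℝ) ^ k := by positivity
  constructor
  · have hY : c / β ^ 2 ≤ Y := by rw [div_le_iff₀ hβ2]; linarith
    have h1 : c / (4 : ℝ) ^ (k + 1) ≤ c / β ^ 2 := div_le_div_of_nonneg_left hc.le hβ2 hlt
    have h2 : c / 4 * ((4 : ℝ) ^ k)⁻¹ = c / (4 : ℝ) ^ (k + 1) := by rw [pow_succ]; field_simp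
    rw [h2]; exact h1.trans hY
  · have hY : Y ≤ C / β ^ 2 := by rw [le_div_iff₀ hβ2]; linarith
    have h1 : C / β ^ 2 ≤ |C| / β ^ 2 := div_le_div_of_nonneg_right (le_abs_self C) hβ2.le
    have h2 : |C| / β ^ 2 ≤ |C| / (4 : ℝ) ^ k := div_le_div_of_nonneg_left (abs_nonneg C) h4pos hle
    rw [← div_eq_mul_inv]
    exact hY.trans (h1.trans h2)

theorem allpairs_to_levels {β C Y : ℝ} {k : ℕ} (h2k : (2 : ℝ) ^ k ≤ β) (_hY : 0 ≤ Y)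
    (h : β ^ 2 * Y ≤ C) : Y ≤ |C| * ((4 : ℝ) ^ k)⁻¹ := by
  have h2kpos : 0 < (2 : ℝ) ^ k := by positivity
  have hβpos : 0 < β := h2kpos.trans_le h2k
  have hβ2 : 0 < β ^ 2 := by positivity
  have h4k : (4 : ℝ) ^ k = ((2 : ℝ) ^ k) ^ 2 := by
    rw [show (4 : ℝ) = 2 ^ 2 by norm_num, ← pow_mul, mul_comm, pow_mul]
  have hle : (4 : ℝ) ^ k ≤ β ^ 2 := by rw [h4k]; exact pow_le_pow_left₀ h2kpos.le h2k 2
  have h4pos : 0 < (4 : ℝ) ^ k := by positivity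
  have h0 : Y ≤ C / β ^ 2 := by rw [le_div_iff₀ hβ2]; linarith
  have h1 : C / β ^ 2 ≤ |C| / β ^ 2 := div_le_div_of_nonneg_right (le_abs_self C) hβ2.le
  have h2 : |C| / β ^ 2 ≤ |C| / (4 : ℝ) ^ k := div_le_div_of_nonneg_left (abs_nonneg C) h4pos hle
  rw [← div_eq_mul_inv]
  exact h0.trans (h1.trans h2)

/-- Torus distances are square roots of positive integers. -/
theorem dist_eq_sqrt_nat {L : ℕ} (x y : Fin 4 → ZMod L) (hxy : x ≠ y) :
    ∃ m : ℕ, 1 ≤ m ∧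
      Real.sqrt (∑ k : Fin 4, (((x k - y k).valMinAbs : ℤ) : ℝ) ^ 2) = Real.sqrt (m : ℝ) := by
  refine ⟨∑ k : Fin 4, ((x k - y k).valMinAbs.natAbs) ^ 2, ?_, ?_⟩
  · obtain ⟨k, hk⟩ := Function.ne_iff.1 hxy
    have hne : (x k - y k).valMinAbs ≠ 0 := by
      rw [Ne, ZMod.valMinAbs_eq_zero, sub_eq_zero]; exact hk
    have h1 : 1 ≤ (x k - y k).valMinAbs.natAbs ^ 2 := by
      have : 1 ≤ (x k - y k).valMinAbs.natAbs := Nat.one_le_iff_ne_zero.2 (Int.natAbs_ne_zero.2 hne)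
      nlinarith
    exact h1.trans (Finset.single_le_sum (f := fun i => ((x i - y i).valMinAbs.natAbs) ^ 2)
      (fun i _ => Nat.zero_le _) (Finset.mem_univ k))
  · congr 1
    push_cast
    refine Finset.sum_congr rfl fun k _ => ?_
    rw [Nat.cast_natAbs, Int.cast_abs, sq_abs]

end Encoding

/-! ## § The skeleton theorem — the ONLY declaration concluding the crux, by name -/

/-- **Skeleton theorem.** `FemtoCurvatureTwoPoint` from the four stubs: C⁺ by
`deepBand_of_stubs`, then the generic-step encoding (a generic band parameter `M' ∈ [M, M+1]`
makes the level sets `√m · e^{-2^k/M'}` of distinct steps disjoint, `a(β) := e^{-2^{k(β)}/M'}`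
with `2^k ≤ β < 2^{k+1}` puts every femto torus `L·a(β) ≤ 1` in the band `log L ≤ β/M`, and
`Γ(√m·a_k) := 4^{-k}` (else `1`) turns `[c, C]·β⁻²` into `[(c/4)Γ, |C|Γ]` in both clauses).
`sorry` enters only through the four `stub_*` theorems. -/
theorem FemtoCurvatureTwoPoint_of :
    Summit.QuantumFields.YangMills.Theses.LangevinControlUV.FemtoCurvatureTwoPoint := by
  -- C⁺ from the four stubs (the only place the stubs enter)
  have hC : DeepBandTwoPoint :=
    deepBand_of_stubs stub_largeFieldDeletion stub_maxwellKernelBand stub_bodyCovarianceDecay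
      stub_bodyAxisTwoSided
  -- encoding: generic step unit map `a(β) = e^{-2^{k(β)}/M'}`, shape `Γ(√m·a_k) = 4^{-k}`
  intro G _ _ _ _ hG r
  obtain ⟨M, β₀, c, C, hM, hc, H⟩ := hC G hG r
  obtain ⟨M', hMM', hgen⟩ := exists_generic hM
  have hM' : 0 < M' := hM.trans_le hMM'
  refine ⟨aEnc M', gammaEnc M', max β₀ 1, 1, c / 4, |C|, one_pos, by positivity,
    fun β => aEnc_pos M' β, tendsto_aEnc hM',
    fun s _ _ => ⟨gammaEnc_pos M' s, gammaEnc_le_one M' s⟩, ?_⟩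
  intro L _ β hβ hLa
  have hβ0 : β₀ ≤ β := (le_max_left _ _).trans hβ
  have hβ1 : 1 ≤ β := (le_max_right _ _).trans hβ
  have h2k : (2 : ℝ) ^ stepIdx β ≤ β := two_pow_stepIdx_le hβ1
  have hβlt : β < (2 : ℝ) ^ (stepIdx β + 1) := lt_two_pow_stepIdx_succ β
  have hβpos : 0 < β := by linarith
  have hL0 : (0 : ℝ) < L := Nat.cast_pos.2 (Nat.pos_of_ne_zero (NeZero.ne L))
  -- femto ⇒ band
  have hlog : Real.log (L : ℝ) ≤ β / M := by
    have ha : (L : ℝ) * Real.exp (-(2 : ℝ) ^ stepIdx β / M') ≤ 1 := hLa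
    have h1 : (L : ℝ) ≤ Real.exp ((2 : ℝ) ^ stepIdx β / M') := by
      calc (L : ℝ) = (L : ℝ) * Real.exp (-(2 : ℝ) ^ stepIdx β / M') *
            Real.exp ((2 : ℝ) ^ stepIdx β / M') := by
              rw [mul_assoc, ← Real.exp_add, neg_div, neg_add_cancel, Real.exp_zero, mul_one]
        _ ≤ 1 * Real.exp ((2 : ℝ) ^ stepIdx β / M') := by gcongr
        _ = Real.exp ((2 : ℝ) ^ stepIdx β / M') := one_mul _
    have h2 : Real.log (L : ℝ) ≤ (2 : ℝ) ^ stepIdx β / M' := (Real.log_le_iff_le_exp hL0).2 h1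
    have h3 : (2 : ℝ) ^ stepIdx β / M' ≤ β / M' := div_le_div_of_nonneg_right h2k hM'.le
    have h4 : β / M' ≤ β / M := div_le_div_of_nonneg_left hβpos.le hM hMM'
    linarith
  have HH := H L β hβ0 hlog
  obtain ⟨hax, hall⟩ := HH
  refine ⟨fun n hn h8 => ?_, fun x y i j i' j' hxy hij hij' => ?_⟩
  · obtain ⟨h_lo, h_hi⟩ := hax n hn h8
    have hΓ : gammaEnc M' ((n : ℝ) * aEnc M' β) = ((4 : ℝ) ^ stepIdx β)⁻¹ := by
      have e : (n : ℝ) * aEnc M' β =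
          Real.sqrt ((n ^ 2 : ℕ) : ℝ) * Real.exp (-(2 : ℝ) ^ stepIdx β / M') := by
        rw [show aEnc M' β = Real.exp (-(2 : ℝ) ^ stepIdx β / M') from rfl]
        congr 1
        push_cast
        rw [Real.sqrt_sq (Nat.cast_nonneg n)]
      rw [e]
      exact gammaEnc_eq hgen (stepIdx β) (n ^ 2) (by nlinarith)
    rw [hΓ]
    exact band_to_levels h2k hβlt hc h_lo h_hi
  · have hxy' := hall x y i j i' j' hxy hij hij'
    obtain ⟨m, hm, hdist⟩ := dist_eq_sqrt_nat x y hxy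
    dsimp only at hxy' ⊢
    rw [hdist] at hxy' ⊢
    have hΓ : gammaEnc M' (Real.sqrt (m : ℝ) * aEnc M' β) = ((4 : ℝ) ^ stepIdx β)⁻¹ :=
      gammaEnc_eq hgen (stepIdx β) m hm
    rw [hΓ]
    exact allpairs_to_levels h2k (by positivity) hxy'

end Summit.QuantumFields.YangMills.Cruxes.FemtoCurvatureTwoPoint.DeepBandGaussianRegime
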